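import Literature.Analysis.FluidPDE.TorusVectorHeatFlow
import Literature.Analysis.FunctionSpaces.TorusClassicalNSPerturbedRestart
import HarnessLib

/-!
# The `C⁰([0,T]; L³)` continuation criterion on `T³` (von Wahl, Giga; Robinson–Sadowski 2014, Cor. 7)

search for candidate a priori estimates; no regularity claim.

Analysis/FluidPDE proof file (theorems only; no definitions, no named facts). Robinson & Sadowski
(*Rend. Semin. Mat. Univ. Padova* **131** (2014), Corollary 7, p. 174) derive from their local
smoothness criterion (Theorem 5, typed on `T³` in `TorusNSHeatFlowCriterion` /
`TorusVectorHeatFlow`) "a simple proof of the `C⁰([0,T]; L³)` regularity condition of von Wahl [20]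
(also derived by Giga [12])": *suppose that `u` is a weak (Leray–Hopf) solution of the Navier–Stokes
equations with `u ∈ C⁰([0,T]; L³)`. Then `u` is regular on `(0, T]`.* The printed proof: with
`M = max_{[0,T]} ‖u(t)‖_{L³}` and `S(τ)` the heat semigroup,
`‖u(t)‖³_{L³} ∫₀^τ ∫ |v_t(s)| |∇v_t(s)|² ds ≤ M³ (‖u(t)‖³_{L³} − ‖S(τ)u(t)‖³_{L³}) ≤ 3M⁵ ‖u(t) − S(τ)u(t)‖_{L³}`
(`v_t` the heat flow of `u(t)`, using (17): `‖S(τ)u‖³_{L³} + 3∫₀^τ I(v) ≤ ‖u‖³_{L³}`), and by the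
continuity of `u` into `L³` on the compact `[0, T]` and the strong continuity of `S(·)` there is ONE
`τ > 0` with `‖u(t) − S(τ)u(t)‖_{L³} < ε/3M⁵` for every `t ∈ [0, T]`; Theorem 5 restarted at `t` then
gives regularity on `(t, t + τ)` for every `t`, "in particular `u` is regular on `(0, T + τ)`".

Here, in the house continuation form for classical solutions on `T^d`, `card d = 3`, `ν > 0`
(the setting of all `TorusNS…Criterion` files): a classical mean-zero solution `(u, p)` of the
unforced equations on `[0, T) × T^d` is automatically continuous into `L³` on `[0, T)`, so
`u ∈ C⁰([0,T]; L³)` means precisely that `u(t)` converges in `L³(T^d)` as `t ↑ T`, equivalently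
(completeness of `L³`) that `u(t)` is `L³`-Cauchy as `t ↑ T`. Under either hypothesis the solution
continues to a classical mean-zero solution on some `[0, T'] × T^d`, `T' > T`:

* `ContinuousL3Criterion.integral_norm_cube_mul_dissipation_le` — the displayed estimate of the
  printed proof with `ν` restored: for a smooth divergence-free solution `v` of `∂ₜv = νΔv` on
  `[0, b] × T^d` with `‖v(0)‖_{L³} ≤ M`,
  `‖v(0)‖³_{L³} ∫₀ᵗ∫|v||∇v|² ≤ ν⁻¹ M⁵ ‖v(0) − v(t)‖_{L³}` (`0 ≤ t ≤ b`);
* `Torus.classicalNS_continuation_of_heatFlow_criterion_restart` — Theorem 5 applied from a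
  restart time `t₀ ∈ [0, T)` (time translation `Torus.IsClassicalNSSolutionOn.comp_add_const`,
  `Torus.classicalNS_continuation_of_heatFlow_criterion'`, and `….glue_restart`);
* `Torus.classicalNS_continuation_of_L3_cauchy` — **Corollary 7** with the hypothesis
  "`u(t)` is Cauchy in `L³(T^d)` as `t ↑ T`";
* `Torus.classicalNS_continuation_of_tendsto_L3` — **Corollary 7** with the hypothesis
  "`∫‖u(t) − u_T‖³ → 0` as `t ↑ T` for some `u_T ∈ L³(T^d)`".

The only deviation from the printed proof is bookkeeping: instead of `M = max_{[0,T]}‖u‖_{L³}`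
and compactness of `[0, T]` we work on a terminal window `[t₁, T)` on which `u` is `L³`-close to
the smooth slice `u(t₁)` (Cauchy hypothesis), so that the uniform smallness of
`‖u(t) − S(ντ)u(t)‖_{L³}` follows from the `L³`-contractivity of the heat flow applied to
`u(t) − u(t₁)` ((17) for the difference of two heat flows) and the continuity at `τ = 0` of the
heat flow of the single smooth field `u(t₁)`; no heat semigroup on non-smooth `L³` data is needed.

## Mathlib / tree search

Reused: `Torus.exists_classical_heatFlow`, `Torus.classicalNS_continuation_of_heatFlow_criterion'`
(`TorusVectorHeatFlow`), `HeatFlowCriterion.heat_integral_norm_cube_add_dissipation_le`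
(`TorusNSHeatFlowCriterion`, (17)), `Torus.IsClassicalNSSolutionOn.comp_add_const`
(`PeriodicBoundedMildTorus`), `….glue_restart` (`TorusClassicalNSPerturbedRestart`), `….mono`,
`Torus.IsSmoothSpaceTimeOn.eventually_norm_sub_lt` (tube lemma), `….hasDerivWithinAt_slice`,
`….timeDerivWithin_eq_of_subset`, `Torus.IsSmooth.memLp`; Mathlib `MemLp.eLpNorm_eq_integral_rpow_norm`,
`eLpNorm_add_le` (Minkowski in `L³`). Searched `lean search 'vonWahl|Giga|C0L3|tendsto.*L3'`: no
`C⁰_t L³_x` criterion in the tree (the `L³` endpoint results present are the small-data door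
`Torus.exists_classicalNS_continuation_of_L3_le` and, on `ℝ³`, `ess_endpoint_holds`).

## References

* J. C. Robinson, W. Sadowski, *A local smoothness criterion for solutions of the 3D Navier–Stokes
  equations*, Rend. Semin. Mat. Univ. Padova 131 (2014) 159–178, Corollary 7 (p. 174) and its
  proof; Theorem 5 (pp. 169–171); (17) (p. 170). (held: paper:doi-10-4171-rsmup-131-9)
  [RobinsonSadowski2014]
* W. von Wahl, *Regularity of weak solutions of the Navier–Stokes equations*, Proc. Sympos. Pure
  Math. 45, Part 2, AMS 1986, 497–503 (ref. [20] of Robinson–Sadowski).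
* Y. Giga, *Solutions for semilinear parabolic equations in `L^p` and regularity of weak solutions
  of the Navier–Stokes system*, J. Differential Equations 62 (1986) 186–212 (ref. [12] of
  Robinson–Sadowski).
-/

noncomputable section

open MeasureTheory Set Filter Topology
open scoped ENNReal

namespace Literature.Analysis.FluidPDE

open Literature.Analysis.FunctionSpaces

variable {d : Type*} [Fintype d] [DecidableEq d]

namespace ContinuousL3Criterion

/-! ## §1 `L³` bookkeeping: Minkowski and elementary bounds -/

omit [Fintype d] [DecidableEq d] in
/-- Minkowski's inequality in `L³` for differences: `‖f − h‖₃ ≤ ‖f − g‖₃ + ‖g − h‖₃`, the norms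
written as `(∫‖·‖³)^{1/3}`. [folklore] -/
private theorem l3_sub_le {α : Type*} [MeasurableSpace α] {μ : Measure α} {E : Type*}
    [NormedAddCommGroup E] {f g h : α → E} (hf : MemLp f 3 μ) (hg : MemLp g 3 μ)
    (hh : MemLp h 3 μ) :
    (∫ x, ‖f x - h x‖ ^ (3 : ℝ) ∂μ) ^ (1 / (3 : ℝ)) ≤
      (∫ x, ‖f x - g x‖ ^ (3 : ℝ) ∂μ) ^ (1 / (3 : ℝ)) +
        (∫ x, ‖g x - h x‖ ^ (3 : ℝ) ∂μ) ^ (1 / (3 : ℝ)) := by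
  have h30 : (3 : ℝ≥0∞) ≠ 0 := by norm_num
  have h3t : (3 : ℝ≥0∞) ≠ ⊤ := by norm_num
  have h3r : (3 : ℝ≥0∞).toReal = 3 := by norm_num
  have key : ∀ {φ : α → E}, MemLp φ 3 μ →
      eLpNorm φ 3 μ = ENNReal.ofReal ((∫ x, ‖φ x‖ ^ (3 : ℝ) ∂μ) ^ (1 / (3 : ℝ))) := by
    intro φ hφ
    rw [hφ.eLpNorm_eq_integral_rpow_norm h30 h3t, h3r, one_div]
  have hfg : MemLp (fun x => f x - g x) 3 μ := hf.sub hg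
  have hgh : MemLp (fun x => g x - h x) 3 μ := hg.sub hh
  have hfh : MemLp (fun x => f x - h x) 3 μ := hf.sub hh
  have hsum : (fun x => f x - h x) = (fun x => f x - g x) + fun x => g x - h x := by
    funext x
    simp only [Pi.add_apply, sub_add_sub_cancel]
  have htri : eLpNorm (fun x => f x - h x) 3 μ ≤
      eLpNorm (fun x => f x - g x) 3 μ + eLpNorm (fun x => g x - h x) 3 μ := by
    rw [hsum]
    exact eLpNorm_add_le hfg.aestronglyMeasurable hgh.aestronglyMeasurable (by norm_num)
  have n1 : 0 ≤ (∫ x, ‖f x - g x‖ ^ (3 : ℝ) ∂μ) ^ (1 / (3 : ℝ)) :=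
    Real.rpow_nonneg (integral_nonneg fun _ => Real.rpow_nonneg (norm_nonneg _) _) _
  have n2 : 0 ≤ (∫ x, ‖g x - h x‖ ^ (3 : ℝ) ∂μ) ^ (1 / (3 : ℝ)) :=
    Real.rpow_nonneg (integral_nonneg fun _ => Real.rpow_nonneg (norm_nonneg _) _) _
  rw [key hfh, key hfg, key hgh, ← ENNReal.ofReal_add n1 n2] at htri
  exact (ENNReal.ofReal_le_ofReal_iff (add_nonneg n1 n2)).1 htri

omit [Fintype d] [DecidableEq d] in
/-- Minkowski, second form: `‖f‖₃ ≤ ‖f − g‖₃ + ‖g‖₃`. [folklore] -/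
private theorem l3_le_sub_add {α : Type*} [MeasurableSpace α] {μ : Measure α} {E : Type*}
    [NormedAddCommGroup E] {f g : α → E} (hf : MemLp f 3 μ) (hg : MemLp g 3 μ) :
    (∫ x, ‖f x‖ ^ (3 : ℝ) ∂μ) ^ (1 / (3 : ℝ)) ≤
      (∫ x, ‖f x - g x‖ ^ (3 : ℝ) ∂μ) ^ (1 / (3 : ℝ)) + (∫ x, ‖g x‖ ^ (3 : ℝ) ∂μ) ^ (1 / (3 : ℝ)) := by
  have h0 : MemLp (fun _ : α => (0 : E)) 3 μ := by
    have : (fun _ : α => (0 : E)) = 0 := rfl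
    rw [this]
    exact MemLp.zero
  simpa only [sub_zero] using l3_sub_le hf hg h0

omit [Fintype d] [DecidableEq d] in
/-- The `L³` distance is symmetric. [folklore] -/
private theorem l3_sub_comm {α : Type*} [MeasurableSpace α] {μ : Measure α} {E : Type*}
    [NormedAddCommGroup E] (f g : α → E) :
    (∫ x, ‖f x - g x‖ ^ (3 : ℝ) ∂μ) = ∫ x, ‖g x - f x‖ ^ (3 : ℝ) ∂μ := by
  refine integral_congr_ae (Eventually.of_forall fun x => ?_)
  simp only [norm_sub_rev]

omit [DecidableEq d] in
/-- A pointwise bound `‖f‖ ≤ δ` on the unit-volume torus gives `‖f‖₃ ≤ δ`. [folklore] -/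
private theorem l3_le_of_norm_le {E : Type*} [NormedAddCommGroup E] {f : UnitAddTorus d → E}
    {δ : ℝ} (hδ : 0 ≤ δ) (hf : ∀ x, ‖f x‖ ≤ δ) :
    (∫ x, ‖f x‖ ^ (3 : ℝ)) ^ (1 / (3 : ℝ)) ≤ δ := by
  have h1 : ∫ x, ‖f x‖ ^ (3 : ℝ) ≤ ∫ _ : UnitAddTorus d, δ ^ (3 : ℝ) := by
    refine integral_mono_of_nonneg (Eventually.of_forall fun x => Real.rpow_nonneg (norm_nonneg _) _)
      (integrable_const _) (Eventually.of_forall fun x => ?_)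
    exact Real.rpow_le_rpow (norm_nonneg _) (hf x) (by norm_num)
  have h2 : ∫ _ : UnitAddTorus d, δ ^ (3 : ℝ) = δ ^ (3 : ℝ) := by simp [integral_const]
  rw [h2] at h1
  calc (∫ x, ‖f x‖ ^ (3 : ℝ)) ^ (1 / (3 : ℝ)) ≤ (δ ^ (3 : ℝ)) ^ (1 / (3 : ℝ)) :=
        Real.rpow_le_rpow (integral_nonneg fun _ => Real.rpow_nonneg (norm_nonneg _) _) h1
          (by norm_num)
    _ = δ := by rw [← Real.rpow_mul hδ]; norm_num

omit [DecidableEq d] in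
/-- `∫‖f‖³ ≤ δ³` gives `‖f‖₃ ≤ δ`. [folklore] -/
private theorem l3_le_of_integral_le {E : Type*} [NormedAddCommGroup E] {f : UnitAddTorus d → E}
    {δ : ℝ} (hδ : 0 ≤ δ) (h : ∫ x, ‖f x‖ ^ (3 : ℝ) ≤ δ ^ 3) :
    (∫ x, ‖f x‖ ^ (3 : ℝ)) ^ (1 / (3 : ℝ)) ≤ δ := by
  calc (∫ x, ‖f x‖ ^ (3 : ℝ)) ^ (1 / (3 : ℝ)) ≤ (δ ^ 3) ^ (1 / (3 : ℝ)) :=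
        Real.rpow_le_rpow (integral_nonneg fun _ => Real.rpow_nonneg (norm_nonneg _) _) h
          (by norm_num)
    _ = δ := by rw [← Real.rpow_natCast δ 3, ← Real.rpow_mul hδ]; norm_num

/-- The cube of the `L³` norm is the integral. [folklore] -/
private theorem l3_pow_three {A : ℝ} (hA : 0 ≤ A) : (A ^ (1 / (3 : ℝ))) ^ 3 = A := by
  rw [← Real.rpow_natCast _ 3, ← Real.rpow_mul hA]; norm_num

/-! ## §2 Heat-flow helpers -/

/-- The Laplacian of a difference of smooth fields. [folklore] -/
private theorem laplacian_sub' {f g : UnitAddTorus d → EuclideanSpace ℝ d} (hf : Torus.IsSmooth f)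
    (hg : Torus.IsSmooth g) (x : UnitAddTorus d) :
    Torus.laplacian (fun y => f y - g y) x = Torus.laplacian f x - Torus.laplacian g x := by
  have hfg : Torus.IsSmooth (fun y => f y - g y) := hf.sub hg
  rw [Torus.laplacian_eq_sum_partialDeriv_partialDeriv hfg,
    Torus.laplacian_eq_sum_partialDeriv_partialDeriv hf,
    Torus.laplacian_eq_sum_partialDeriv_partialDeriv hg, ← Finset.sum_sub_distrib]
  refine Finset.sum_congr rfl fun j _ => ?_
  have h1 : Torus.partialDeriv j (fun y => f y - g y) =
      Torus.partialDeriv j f - Torus.partialDeriv j g :=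
    Torus.partialDeriv_sub (hf.isContDiff (by simp)) (hg.isContDiff (by simp)) j
  rw [h1, Torus.partialDeriv_sub ((hf.partialDeriv j).isContDiff (by simp))
    ((hg.partialDeriv j).isContDiff (by simp)) j]
  rfl

/-- **`L³` contraction for the difference of two heat flows** ((17) of Robinson–Sadowski applied to
`v₁ − v₂`, which is again a smooth divergence-free solution of `∂ₜw = νΔw`):
`∫‖v₁(t) − v₂(t)‖³ ≤ ∫‖v₁(0) − v₂(0)‖³`. [folklore] -/
private theorem heat_l3_sub_le {ν b : ℝ} (hν : 0 < ν) (hb : 0 < b)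
    {v₁ v₂ : ℝ → UnitAddTorus d → EuclideanSpace ℝ d}
    (h₁ : Torus.IsSmoothSpaceTimeOn (Icc 0 b) v₁)
    (h₁heat : ∀ t ∈ Icc 0 b, ∀ x,
      Torus.timeDerivWithin (Icc 0 b) v₁ t x = ν • Torus.laplacian (v₁ t) x)
    (h₁div : ∀ t ∈ Icc 0 b, Torus.IsDivFree (v₁ t))
    (h₂ : Torus.IsSmoothSpaceTimeOn (Icc 0 b) v₂)
    (h₂heat : ∀ t ∈ Icc 0 b, ∀ x,
      Torus.timeDerivWithin (Icc 0 b) v₂ t x = ν • Torus.laplacian (v₂ t) x)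
    (h₂div : ∀ t ∈ Icc 0 b, Torus.IsDivFree (v₂ t)) {t : ℝ} (ht : t ∈ Icc 0 b) :
    ∫ x, ‖v₁ t x - v₂ t x‖ ^ (3 : ℝ) ≤ ∫ x, ‖v₁ 0 x - v₂ 0 x‖ ^ (3 : ℝ) := by
  have hws : Torus.IsSmoothSpaceTimeOn (Icc 0 b) (fun s y => v₁ s y - v₂ s y) := h₁.sub h₂
  have hU : UniqueDiffOn ℝ (Icc 0 b) := uniqueDiffOn_Icc hb
  have hwheat : ∀ s ∈ Icc 0 b, ∀ x, Torus.timeDerivWithin (Icc 0 b) (fun s y => v₁ s y - v₂ s y) s x =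
      ν • Torus.laplacian ((fun s y => v₁ s y - v₂ s y) s) x := by
    intro s hs x
    have hd := ((h₁.hasDerivWithinAt_slice hs x).sub (h₂.hasDerivWithinAt_slice hs x)).derivWithin
      (hU s hs)
    unfold Torus.timeDerivWithin
    show derivWithin (fun τ => v₁ τ x - v₂ τ x) (Icc 0 b) s =
      ν • Torus.laplacian (fun y => v₁ s y - v₂ s y) x
    rw [show (fun τ => v₁ τ x - v₂ τ x) = ((fun τ => v₁ τ x) - fun τ => v₂ τ x) from rfl, hd,
      h₁heat s hs x, h₂heat s hs x, ← smul_sub,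
      ← laplacian_sub' (h₁.isSmooth_slice hs) (h₂.isSmooth_slice hs)]
  have hwdiv : ∀ s ∈ Icc 0 b, Torus.IsDivFree ((fun s y => v₁ s y - v₂ s y) s) := by
    intro s hs x
    have e : (fun y => v₁ s y - v₂ s y) = v₁ s - v₂ s := rfl
    show Torus.divergence (fun y => v₁ s y - v₂ s y) x = 0
    rw [e, Torus.divergence_sub ((h₁.isSmooth_slice hs).isContDiff (by simp))
      ((h₂.isSmooth_slice hs).isContDiff (by simp)), h₁div s hs x, h₂div s hs x, sub_zero]
  have h17 := HeatFlowCriterion.heat_integral_norm_cube_add_dissipation_le hν hb hws hwheat hwdiv ht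
  have hJ : 0 ≤ ∫ s in (0 : ℝ)..t, ∫ x, ‖(fun s y => v₁ s y - v₂ s y) s x‖ *
      ∑ k, ‖Torus.partialDeriv k ((fun s y => v₁ s y - v₂ s y) s) x‖ ^ 2 :=
    intervalIntegral.integral_nonneg ht.1 fun s _ => integral_nonneg fun x =>
      mul_nonneg (norm_nonneg _) (Finset.sum_nonneg fun k _ => sq_nonneg _)
  have h3 : 0 ≤ 3 * ν * ∫ s in (0 : ℝ)..t, ∫ x, ‖(fun s y => v₁ s y - v₂ s y) s x‖ *
      ∑ k, ‖Torus.partialDeriv k ((fun s y => v₁ s y - v₂ s y) s) x‖ ^ 2 :=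
    mul_nonneg (by positivity) hJ
  have := h17
  simp only at this h3
  linarith

/-- **Robinson–Sadowski 2014, the estimate in the proof of Corollary 7 (p. 174), with `ν`
restored.** For a jointly smooth solution `v` of `∂ₜv = νΔv` on `[0, b] × T^d` with
divergence-free slices and `‖v(0)‖_{L³} ≤ M`, and `0 ≤ t ≤ b`:
`‖v(0)‖³_{L³} ∫₀ᵗ ∫ |v| Σₖ|∂ₖv|² ≤ ν⁻¹ M⁵ ‖v(0) − v(t)‖_{L³}`
(printed, `ν = 1`, `S(t)u = v(t)`: "`‖u‖³ ∫₀ᵗ |v_t(s)| |∇v_t(s)|² ds ≤ M³(‖u‖³ − ‖S(t)u‖³)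
≤ M³(‖u‖ − ‖S(t)u‖)[‖u‖² + ‖u‖‖S(t)u‖ + ‖S(t)u‖²] ≤ 3M⁵(‖u‖ − ‖S(t)u‖)` since
`‖S(t)u‖_{L³} ≤ ‖u‖_{L³}`", from (17) `‖S(t)u‖³ + 3∫₀ᵗ I(v) ≤ ‖u‖³; the factor `3` of (17) is
kept here, and `‖u‖ − ‖S(t)u‖ ≤ ‖u − S(t)u‖`).
[cite: RobinsonSadowski2014, proof of Corollary 7 (p. 174)] -/
theorem integral_norm_cube_mul_dissipation_le {ν b : ℝ} (hν : 0 < ν) (hb : 0 < b)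
    {v : ℝ → UnitAddTorus d → EuclideanSpace ℝ d} (hv : Torus.IsSmoothSpaceTimeOn (Icc 0 b) v)
    (hheat : ∀ t ∈ Icc 0 b, ∀ x,
      Torus.timeDerivWithin (Icc 0 b) v t x = ν • Torus.laplacian (v t) x)
    (hdiv : ∀ t ∈ Icc 0 b, Torus.IsDivFree (v t)) {M : ℝ}
    (hM : (∫ x, ‖v 0 x‖ ^ (3 : ℝ)) ^ (1 / (3 : ℝ)) ≤ M) {t : ℝ} (ht : t ∈ Icc 0 b) :
    (∫ x, ‖v 0 x‖ ^ (3 : ℝ)) *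
        ∫ s in (0 : ℝ)..t, ∫ x, ‖v s x‖ * ∑ k, ‖Torus.partialDeriv k (v s) x‖ ^ 2 ≤
      ν⁻¹ * M ^ 5 * (∫ x, ‖v 0 x - v t x‖ ^ (3 : ℝ)) ^ (1 / (3 : ℝ)) := by
  have h0 : (0 : ℝ) ∈ Icc 0 b := ⟨le_rfl, hb.le⟩
  set A : ℝ := ∫ x, ‖v 0 x‖ ^ (3 : ℝ) with hA
  set B : ℝ := ∫ x, ‖v t x‖ ^ (3 : ℝ) with hB
  set J : ℝ := ∫ s in (0 : ℝ)..t, ∫ x, ‖v s x‖ * ∑ k, ‖Torus.partialDeriv k (v s) x‖ ^ 2 with hJ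
  set δ' : ℝ := (∫ x, ‖v 0 x - v t x‖ ^ (3 : ℝ)) ^ (1 / (3 : ℝ)) with hδ'
  have h17 : B + 3 * ν * J ≤ A :=
    HeatFlowCriterion.heat_integral_norm_cube_add_dissipation_le hν hb hv hheat hdiv ht
  have hJ0 : 0 ≤ J :=
    intervalIntegral.integral_nonneg ht.1 fun s _ => integral_nonneg fun x =>
      mul_nonneg (norm_nonneg _) (Finset.sum_nonneg fun k _ => sq_nonneg _)
  have hA0 : 0 ≤ A := integral_nonneg fun _ => Real.rpow_nonneg (norm_nonneg _) _
  have hB0 : 0 ≤ B := integral_nonneg fun _ => Real.rpow_nonneg (norm_nonneg _) _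
  have hδ'0 : 0 ≤ δ' := Real.rpow_nonneg (integral_nonneg fun _ => Real.rpow_nonneg (norm_nonneg _) _) _
  set a : ℝ := A ^ (1 / (3 : ℝ)) with ha
  set b' : ℝ := B ^ (1 / (3 : ℝ)) with hb'
  have ha0 : 0 ≤ a := Real.rpow_nonneg hA0 _
  have hb0 : 0 ≤ b' := Real.rpow_nonneg hB0 _
  have ha3 : a ^ 3 = A := l3_pow_three hA0
  have hb3 : b' ^ 3 = B := l3_pow_three hB0
  have hνJ : 0 ≤ 3 * ν * J := mul_nonneg (by positivity) hJ0
  have hBA : B ≤ A := by linarith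
  have hba : b' ≤ a := Real.rpow_le_rpow hB0 hBA (by norm_num)
  have haM : a ≤ M := hM
  have hbM : b' ≤ M := hba.trans haM
  -- Minkowski: `a ≤ δ' + b'`
  have hmink : a ≤ δ' + b' :=
    l3_le_sub_add ((hv.isSmooth_slice h0).memLp 3) ((hv.isSmooth_slice ht).memLp 3)
  have hq : a ^ 2 + a * b' + b' ^ 2 ≤ 3 * M ^ 2 := by nlinarith
  have hq0 : 0 ≤ a ^ 2 + a * b' + b' ^ 2 := by positivity
  have hAB : A - B ≤ δ' * (3 * M ^ 2) := by
    have e : A - B = (a - b') * (a ^ 2 + a * b' + b' ^ 2) := by rw [← ha3, ← hb3]; ring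
    rw [e]
    exact mul_le_mul (by linarith) hq hq0 hδ'0
  have hJle : J ≤ M ^ 2 * δ' / ν := by
    rw [le_div_iff₀ hν]
    nlinarith
  have hM0 : 0 ≤ M := ha0.trans haM
  calc A * J ≤ M ^ 3 * (M ^ 2 * δ' / ν) := by
        refine mul_le_mul ?_ hJle hJ0 (by positivity)
        calc A = a ^ 3 := ha3.symm
          _ ≤ M ^ 3 := pow_le_pow_left₀ ha0 haM 3
    _ = ν⁻¹ * M ^ 5 * δ' := by
        rw [div_eq_mul_inv]
        ring

end ContinuousL3Criterion

open ContinuousL3Criterion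

/-! ## §3 Theorem 5 from a restart time -/

/-- **Robinson–Sadowski 2014, Theorem 5, applied from a restart time `t₀ ∈ [0, T)`** (the form
used in the proof of Corollary 7: "in particular `u` is regular on `(0, T + t)`"). There is
`ε = ε(d) > 0` such that: if `(u, p)` is a classical mean-zero solution of the unforced
Navier–Stokes equations (`ν > 0`) on `[0, T) × T^d`, `card d = 3`, `0 ≤ t₀ < T`, `v` is a jointly
smooth solution of `∂ₜv = νΔv` on `[0, T − t₀] × T^d` with `v(0) = u(t₀)` (the heat flow of the
restart datum), and `(∫‖u(t₀)‖³) ∫₀ˢ∫‖v‖∑ₖ‖∂ₖv‖² ≤ ε ν⁵` for all `s < T − t₀`, then `u` continues to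
a classical mean-zero solution on some `[0, T'] × T^d`, `T' > T`. Proof: the equations are
autonomous, so `s ↦ (u, p)(s + t₀)` is a classical solution on `[0, T − t₀)`
(`Torus.IsClassicalNSSolutionOn.comp_add_const`) to which
`Torus.classicalNS_continuation_of_heatFlow_criterion'` applies; the continuation, translated
back, is restarted-and-glued onto `u` (`Torus.IsClassicalNSSolutionOn.glue_restart`: forward
uniqueness identifies the two on the overlap).
[cite: RobinsonSadowski2014, Theorem 5 (pp. 169–171) with the proof of Corollary 7 (p. 174)] -/
theorem Torus.classicalNS_continuation_of_heatFlow_criterion_restart (hd : Fintype.card d = 3) :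
    ∃ ε : ℝ, 0 < ε ∧ ∀ {ν T t₀ : ℝ}, 0 < ν → 0 ≤ t₀ → t₀ < T →
      ∀ {u v : ℝ → UnitAddTorus d → EuclideanSpace ℝ d} {p : ℝ → UnitAddTorus d → ℝ},
        Torus.IsClassicalNSSolutionOn (Ico 0 T) ν 0 u p →
        (∀ t ∈ Ico 0 T, Torus.HasZeroMean (u t)) →
        Torus.IsSmoothSpaceTimeOn (Icc 0 (T - t₀)) v →
        (∀ t ∈ Icc 0 (T - t₀), ∀ x,
          Torus.timeDerivWithin (Icc 0 (T - t₀)) v t x = ν • Torus.laplacian (v t) x) →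
        v 0 = u t₀ →
        (∀ t ∈ Ico 0 (T - t₀), (∫ x, ‖u t₀ x‖ ^ (3 : ℝ)) *
            ∫ s in (0 : ℝ)..t, ∫ x, ‖v s x‖ * ∑ k, ‖Torus.partialDeriv k (v s) x‖ ^ 2 ≤
              ε * ν ^ 5) →
        ∃ T' : ℝ, T < T' ∧ ∃ (u' : ℝ → UnitAddTorus d → EuclideanSpace ℝ d)
          (p' : ℝ → UnitAddTorus d → ℝ), Torus.IsClassicalNSSolutionOn (Icc 0 T') ν 0 u' p' ∧
            (∀ t ∈ Icc 0 T', Torus.HasZeroMean (u' t)) ∧ ∀ t ∈ Ico 0 T, u' t = u t := by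
  obtain ⟨ε, hε, hmain⟩ := Torus.classicalNS_continuation_of_heatFlow_criterion' (d := d) hd
  refine ⟨ε, hε, fun {ν T t₀} hν ht₀ ht₀T {u v p} h hmean hv hheat hv0 hsmall => ?_⟩
  have hS0 : 0 < T - t₀ := by linarith
  -- the translated solution `s ↦ (u, p)(s + t₀)` on `[0, T - t₀)`
  have hsub : Ico 0 (T - t₀) ⊆ (fun s => s + t₀) ⁻¹' Ico 0 T := by
    intro s hs
    exact ⟨by linarith [hs.1], by linarith [hs.2]⟩
  have hũ : Torus.IsClassicalNSSolutionOn (Ico 0 (T - t₀)) ν 0 (fun s => u (s + t₀))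
      (fun s => p (s + t₀)) :=
    (h.comp_add_const t₀).mono hsub (uniqueDiffOn_Ico 0 (T - t₀))
  have hmeanũ : ∀ s ∈ Ico 0 (T - t₀), Torus.HasZeroMean ((fun s => u (s + t₀)) s) :=
    fun s hs => hmean (s + t₀) (hsub hs)
  have hv0' : v 0 = (fun s => u (s + t₀)) 0 := by
    show v 0 = u (0 + t₀)
    rw [zero_add]
    exact hv0
  have hsmall' : ∀ t ∈ Ico 0 (T - t₀), (∫ x, ‖(fun s => u (s + t₀)) 0 x‖ ^ (3 : ℝ)) *
      ∫ s in (0 : ℝ)..t, ∫ x, ‖v s x‖ * ∑ k, ‖Torus.partialDeriv k (v s) x‖ ^ 2 ≤ ε * ν ^ 5 := by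
    intro t ht
    have e : (fun s => u (s + t₀)) 0 = u t₀ := by
      show u (0 + t₀) = u t₀
      rw [zero_add]
    rw [e]
    exact hsmall t ht
  obtain ⟨S', hSS', ũ', q', hsol', hmean', hagree'⟩ :=
    hmain hν hS0 hũ hmeanũ hv hheat hv0' hsmall'
  -- translate back: `t ↦ (ũ', q')(t - t₀)` on `[t₀, t₀ + S']`
  have hsub2 : Icc t₀ (t₀ + S') ⊆ (fun s => s + -t₀) ⁻¹' Icc 0 S' := by
    intro s hs
    exact ⟨by linarith [hs.1], by linarith [hs.2]⟩
  have ht₀S' : t₀ < t₀ + S' := by linarith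
  have hu₂ : Torus.IsClassicalNSSolutionOn (Icc t₀ (t₀ + S')) ν 0 (fun s => ũ' (s + -t₀))
      (fun s => q' (s + -t₀)) :=
    (hsol'.comp_add_const (-t₀)).mono hsub2 (uniqueDiffOn_Icc ht₀S')
  -- the first window `[0, b]`, `b = (t₀ + T)/2`, and the gluing
  set b : ℝ := (t₀ + T) / 2 with hb
  have ht₀b : t₀ < b := by rw [hb]; linarith
  have hbT : b < T := by rw [hb]; linarith
  have h₁ : Torus.IsClassicalNSSolutionOn (Icc 0 b) ν 0 u p :=
    h.mono (fun s hs => ⟨hs.1, lt_of_le_of_lt hs.2 hbT⟩) (uniqueDiffOn_Icc (ht₀.trans_lt ht₀b))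
  have hbS' : b ≤ t₀ + S' := by linarith
  have h0 : (fun s => ũ' (s + -t₀)) t₀ = u t₀ := by
    show ũ' (t₀ + -t₀) = u t₀
    rw [add_neg_cancel, hagree' 0 ⟨le_rfl, hS0⟩]
    show u (0 + t₀) = u t₀
    rw [zero_add]
  obtain ⟨u', p', hsol, -, hcases⟩ := h₁.glue_restart hν.le hu₂ ht₀ ht₀b hbS' h0
  refine ⟨t₀ + S', by linarith, u', p', hsol, fun t ht => ?_, fun t ht => ?_⟩
  · rcases hcases t ht with ⟨ht1, hte⟩ | ⟨ht2, hte⟩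
    · rw [hte]
      exact hmean t ⟨ht1.1, lt_of_le_of_lt ht1.2 hbT⟩
    · rw [hte]
      exact hmean' (t + -t₀) ⟨by linarith [ht2.1], by linarith [ht2.2]⟩
  · have ht' : t ∈ Icc 0 (t₀ + S') := ⟨ht.1, by linarith [ht.2]⟩
    rcases hcases t ht' with ⟨-, hte⟩ | ⟨ht2, hte⟩
    · exact hte
    · rw [hte]
      show ũ' (t + -t₀) = u t
      have hmem : t + -t₀ ∈ Ico 0 (T - t₀) := ⟨by linarith [ht2.1], by linarith [ht.2]⟩
      rw [hagree' _ hmem]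
      show u (t + -t₀ + t₀) = u t
      rw [neg_add_cancel_right]

/-! ## §4 Corollary 7: the `C⁰([0,T]; L³)` criterion -/

/-- **The `C⁰([0,T]; L³)` criterion on `T³`, continuation form, Cauchy hypothesis** (von Wahl 1986,
Giga 1986; Robinson–Sadowski 2014, Corollary 7: "Suppose that `u` is a weak (Leray–Hopf) solution
of the Navier–Stokes equations with `u ∈ C⁰([0,T]; L³)`. Then `u` is regular on `(0, T]`."). On
`T^d`, `card d = 3`, `ν > 0`: let `(u, p)` be a classical mean-zero solution of the unforced
Navier–Stokes equations on `[0, T) × T^d`, `T > 0` (hence continuous into `L³` on `[0, T)`), and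
suppose `u(t)` is Cauchy in `L³(T^d)` as `t ↑ T` — for every `η > 0` there is `t₁ < T` with
`∫‖u(t) − u(t')‖³ ≤ η` for all `t, t' ∈ [t₁, T)` — i.e. `u ∈ C⁰([0,T]; L³)`. Then the solution
continues to a classical mean-zero solution on some `[0, T'] × T^d`, `T' > T`, equal to `u` on
`[0, T)`. Proof (printed proof of Corollary 7 with `ν` restored and the compactness of `[0, T]`
replaced by a terminal window): on a window `[t₁, T)` one has `‖u(t)‖_{L³} ≤ M` and
`‖u(t) − u(t')‖_{L³} ≤ δ`, `δ = εν⁶/(3M⁵)`; with `τ ∈ (0, 1]` such that the heat flow `v₁` of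
`u(t₁)` satisfies `‖v₁(s) − u(t₁)‖_{L³} ≤ δ` for `s ≤ τ` (tube lemma) and `t₀ = max(t₁, T − τ/2)`,
the heat flow `v` of `u(t₀)` satisfies `‖v(s) − u(t₀)‖_{L³} ≤ 3δ` for `s ≤ τ` (`L³`-contraction
of `v − v₁`, (17)), hence by `ContinuousL3Criterion.integral_norm_cube_mul_dissipation_le`
`‖u(t₀)‖³_{L³}∫₀ˢ I(v) ≤ ν⁻¹M⁵ · 3δ = εν⁵` for `s < T − t₀ ≤ τ/2`, and Theorem 5 restarted at `t₀`
(`Torus.classicalNS_continuation_of_heatFlow_criterion_restart`) continues `u` past `T`.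
[cite: RobinsonSadowski2014, Corollary 7 (p. 174)] -/
theorem Torus.classicalNS_continuation_of_L3_cauchy (hd : Fintype.card d = 3) {ν T : ℝ}
    (hν : 0 < ν)
    {u : ℝ → UnitAddTorus d → EuclideanSpace ℝ d} {p : ℝ → UnitAddTorus d → ℝ}
    (h : Torus.IsClassicalNSSolutionOn (Ico 0 T) ν 0 u p)
    (hmean : ∀ t ∈ Ico 0 T, Torus.HasZeroMean (u t))
    (hC : ∀ η : ℝ, 0 < η → ∃ t₁ ∈ Ico 0 T, ∀ t ∈ Ico t₁ T, ∀ t' ∈ Ico t₁ T,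
      ∫ x, ‖u t x - u t' x‖ ^ (3 : ℝ) ≤ η) :
    ∃ T' : ℝ, T < T' ∧ ∃ (u' : ℝ → UnitAddTorus d → EuclideanSpace ℝ d)
      (p' : ℝ → UnitAddTorus d → ℝ), Torus.IsClassicalNSSolutionOn (Icc 0 T') ν 0 u' p' ∧
        (∀ t ∈ Icc 0 T', Torus.HasZeroMean (u' t)) ∧ ∀ t ∈ Ico 0 T, u' t = u t := by
  obtain ⟨ε, hε, hrestart⟩ :=
    Torus.classicalNS_continuation_of_heatFlow_criterion_restart (d := d) hd
  have hsm : ∀ t ∈ Ico 0 T, Torus.IsSmooth (u t) := fun t ht =>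
    h.smooth_velocity.isSmooth_slice ht
  -- Step 1: an `L³` bound `M` on a terminal window `[t₂, T)`
  obtain ⟨t₂, ht₂, hC₂⟩ := hC 1 one_pos
  set M : ℝ := (∫ x, ‖u t₂ x‖ ^ (3 : ℝ)) ^ (1 / (3 : ℝ)) + 1 with hM
  have hA₂ : 0 ≤ (∫ x, ‖u t₂ x‖ ^ (3 : ℝ)) ^ (1 / (3 : ℝ)) :=
    Real.rpow_nonneg (integral_nonneg fun _ => Real.rpow_nonneg (norm_nonneg _) _) _
  have hM0 : 0 < M := by rw [hM]; linarith
  have hbound : ∀ t ∈ Ico t₂ T, (∫ x, ‖u t x‖ ^ (3 : ℝ)) ^ (1 / (3 : ℝ)) ≤ M := by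
    intro t ht
    have htT : t ∈ Ico 0 T := ⟨ht₂.1.trans ht.1, ht.2⟩
    have h1 : (∫ x, ‖u t x - u t₂ x‖ ^ (3 : ℝ)) ^ (1 / (3 : ℝ)) ≤ 1 :=
      l3_le_of_integral_le zero_le_one (by rw [one_pow]; exact hC₂ t ht t₂ ⟨le_rfl, ht₂.2⟩)
    have h2 := l3_le_sub_add (μ := volume) ((hsm t htT).memLp 3) ((hsm t₂ ht₂).memLp 3)
    rw [hM]
    linarith
  -- Step 2: the tolerance `δ` and a terminal window `[t₁, T)` of `L³`-oscillation `≤ δ`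
  set δ : ℝ := ε * ν ^ 6 / (3 * M ^ 5) with hδ
  have hδ0 : 0 < δ := by positivity
  obtain ⟨t₃, ht₃, hC₃⟩ := hC (δ ^ 3) (pow_pos hδ0 3)
  set t₁ : ℝ := max t₂ t₃ with ht₁
  have ht₁T : t₁ ∈ Ico 0 T := ⟨ht₂.1.trans (le_max_left _ _), max_lt ht₂.2 ht₃.2⟩
  have hosc : ∀ t ∈ Ico t₁ T, ∀ t' ∈ Ico t₁ T,
      (∫ x, ‖u t x - u t' x‖ ^ (3 : ℝ)) ^ (1 / (3 : ℝ)) ≤ δ := fun t ht t' ht' =>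
    l3_le_of_integral_le hδ0.le (hC₃ t ⟨(le_max_right _ _).trans ht.1, ht.2⟩ t'
      ⟨(le_max_right _ _).trans ht'.1, ht'.2⟩)
  have hbd : ∀ t ∈ Ico t₁ T, (∫ x, ‖u t x‖ ^ (3 : ℝ)) ^ (1 / (3 : ℝ)) ≤ M := fun t ht =>
    hbound t ⟨(le_max_left _ _).trans ht.1, ht.2⟩
  -- Step 3: the heat flow `v₁` of the anchor slice `u(t₁)` on `[0, 1]` and the lapse `τ`
  obtain ⟨v₁, hv₁s, hv₁heat, hv₁0, hv₁div, -, -⟩ :=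
    Torus.exists_classical_heatFlow (d := d) hν one_pos (hsm t₁ ht₁T)
  have hev := hv₁s.eventually_norm_sub_lt (t := 0) ⟨le_rfl, zero_le_one⟩ hδ0
  obtain ⟨τ, hτ0, hτ1, hτ⟩ : ∃ τ : ℝ, 0 < τ ∧ τ ≤ 1 ∧
      ∀ s ∈ Icc 0 τ, ∀ x, ‖v₁ s x - v₁ 0 x‖ < δ := by
    rw [eventually_nhdsWithin_iff, Metric.eventually_nhds_iff] at hev
    obtain ⟨r, hr, hr'⟩ := hev
    refine ⟨min (r / 2) 1, by positivity, min_le_right _ _, fun s hs x => ?_⟩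
    have hs1 : s ∈ Icc (0 : ℝ) 1 := ⟨hs.1, hs.2.trans (min_le_right _ _)⟩
    have hsr : dist s 0 < r := by
      rw [Real.dist_eq, sub_zero, abs_of_nonneg hs.1]
      exact lt_of_le_of_lt (hs.2.trans (min_le_left _ _)) (by linarith)
    exact hr' hsr hs1 x
  -- Step 4: the restart time `t₀ = max t₁ (T - τ/2)` and the heat flow `v` of `u(t₀)` on `[0, τ]`
  set t₀ : ℝ := max t₁ (T - τ / 2) with ht₀
  have ht₁t₀ : t₁ ≤ t₀ := le_max_left _ _
  have ht₀T : t₀ < T := max_lt ht₁T.2 (by linarith)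
  have ht₀0 : 0 ≤ t₀ := ht₁T.1.trans ht₁t₀
  have ht₀mem : t₀ ∈ Ico t₁ T := ⟨ht₁t₀, ht₀T⟩
  have ht₀memT : t₀ ∈ Ico 0 T := ⟨ht₀0, ht₀T⟩
  have hSτ : T - t₀ ≤ τ / 2 := by
    have := le_max_right t₁ (T - τ / 2)
    rw [← ht₀] at this
    linarith
  obtain ⟨v, hvs, hvheat, hv0, hvdiv, -, -⟩ :=
    Torus.exists_classical_heatFlow (d := d) hν hτ0 (hsm t₀ ht₀memT)
  have hvdiv' : ∀ s ∈ Icc 0 τ, Torus.IsDivFree (v s) := hvdiv (h.divFree t₀ ht₀memT)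
  -- `v₁` restricted to `[0, τ]`
  have hsub1 : Icc 0 τ ⊆ Icc (0 : ℝ) 1 := Icc_subset_Icc le_rfl hτ1
  have hv₁s' : Torus.IsSmoothSpaceTimeOn (Icc 0 τ) v₁ := hv₁s.mono hsub1
  have hv₁heat' : ∀ s ∈ Icc 0 τ, ∀ x,
      Torus.timeDerivWithin (Icc 0 τ) v₁ s x = ν • Torus.laplacian (v₁ s) x := by
    intro s hs x
    rw [hv₁s.timeDerivWithin_eq_of_subset hsub1 (uniqueDiffOn_Icc hτ0) hs x]
    exact hv₁heat s (hsub1 hs) x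
  have hv₁div' : ∀ s ∈ Icc 0 τ, Torus.IsDivFree (v₁ s) := fun s hs =>
    hv₁div (h.divFree t₁ ht₁T) s (hsub1 hs)
  -- Step 5: `‖v(0) - v(s)‖₃ ≤ 3δ` for `s ∈ [0, τ]`
  have hclose : ∀ s ∈ Icc 0 τ,
      (∫ x, ‖v 0 x - v s x‖ ^ (3 : ℝ)) ^ (1 / (3 : ℝ)) ≤ 3 * δ := by
    intro s hs
    have hvs_s : Torus.IsSmooth (v s) := hvs.isSmooth_slice hs
    have hv₁_s : Torus.IsSmooth (v₁ s) := hv₁s'.isSmooth_slice hs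
    -- (a) `‖v(s) - v₁(s)‖₃ ≤ δ`: `L³`-contraction of the difference of the two heat flows
    have ha : (∫ x, ‖v s x - v₁ s x‖ ^ (3 : ℝ)) ^ (1 / (3 : ℝ)) ≤ δ := by
      have h17 := heat_l3_sub_le hν hτ0 hvs hvheat hvdiv' hv₁s' hv₁heat' hv₁div' hs
      refine l3_le_of_integral_le hδ0.le (h17.trans ?_)
      rw [hv0, hv₁0]
      exact hC₃ t₀ ⟨(le_max_right _ _).trans ht₀mem.1, ht₀T⟩ t₁ ⟨le_max_right _ _, ht₁T.2⟩
    -- (b) `‖v₁(s) - u(t₁)‖₃ ≤ δ`: the tube lemma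
    have hb : (∫ x, ‖v₁ s x - u t₁ x‖ ^ (3 : ℝ)) ^ (1 / (3 : ℝ)) ≤ δ := by
      rw [← hv₁0]
      exact l3_le_of_norm_le hδ0.le fun x => (hτ s hs x).le
    -- (c) `‖u(t₁) - u(t₀)‖₃ ≤ δ`: the Cauchy window
    have hc : (∫ x, ‖u t₁ x - u t₀ x‖ ^ (3 : ℝ)) ^ (1 / (3 : ℝ)) ≤ δ :=
      hosc t₁ ⟨le_rfl, ht₁T.2⟩ t₀ ht₀mem
    have m1 := l3_sub_le (μ := volume) (hvs_s.memLp 3) (hv₁_s.memLp 3)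
      ((hsm t₁ ht₁T).memLp 3)
    have m2 := l3_sub_le (μ := volume) (hvs_s.memLp 3) ((hsm t₁ ht₁T).memLp 3)
      ((hsm t₀ ht₀memT).memLp 3)
    rw [l3_sub_comm, hv0]
    linarith
  -- Step 6: the criterion from the restart time `t₀`
  have hS0 : 0 < T - t₀ := by linarith
  have hSτ' : T - t₀ ≤ τ := by linarith
  have hsubS : Icc 0 (T - t₀) ⊆ Icc 0 τ := Icc_subset_Icc le_rfl hSτ'
  have hvS : Torus.IsSmoothSpaceTimeOn (Icc 0 (T - t₀)) v := hvs.mono hsubS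
  have hvheatS : ∀ s ∈ Icc 0 (T - t₀), ∀ x,
      Torus.timeDerivWithin (Icc 0 (T - t₀)) v s x = ν • Torus.laplacian (v s) x := by
    intro s hs x
    rw [hvs.timeDerivWithin_eq_of_subset hsubS (uniqueDiffOn_Icc hS0) hs x]
    exact hvheat s (hsubS hs) x
  have hcrit : ∀ t ∈ Ico 0 (T - t₀), (∫ x, ‖u t₀ x‖ ^ (3 : ℝ)) *
      ∫ s in (0 : ℝ)..t, ∫ x, ‖v s x‖ * ∑ k, ‖Torus.partialDeriv k (v s) x‖ ^ 2 ≤ ε * ν ^ 5 := by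
    intro t ht
    have htτ : t ∈ Icc 0 τ := ⟨ht.1, ht.2.le.trans hSτ'⟩
    have hM' : (∫ x, ‖v 0 x‖ ^ (3 : ℝ)) ^ (1 / (3 : ℝ)) ≤ M := by
      rw [hv0]
      exact hbd t₀ ht₀mem
    have hcore := integral_norm_cube_mul_dissipation_le hν hτ0 hvs hvheat hvdiv' hM' htτ
    have hcl := hclose t htτ
    rw [hv0] at hcore hcl
    calc (∫ x, ‖u t₀ x‖ ^ (3 : ℝ)) *
          ∫ s in (0 : ℝ)..t, ∫ x, ‖v s x‖ * ∑ k, ‖Torus.partialDeriv k (v s) x‖ ^ 2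
        ≤ ν⁻¹ * M ^ 5 * (∫ x, ‖u t₀ x - v t x‖ ^ (3 : ℝ)) ^ (1 / (3 : ℝ)) := hcore
      _ ≤ ν⁻¹ * M ^ 5 * (3 * δ) := mul_le_mul_of_nonneg_left hcl (by positivity)
      _ = ε * ν ^ 5 := by
          rw [hδ]
          field_simp
  exact hrestart hν ht₀0 ht₀T h hmean hvS hvheatS hv0 hcrit

/-- **The `C⁰([0,T]; L³)` criterion on `T³`, continuation form, limit hypothesis** (von Wahl 1986,
Giga 1986; Robinson–Sadowski 2014, Corollary 7). Same setting as
`Torus.classicalNS_continuation_of_L3_cauchy`, with the hypothesis in the form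
"`u(t) → u_T` in `L³(T^d)` as `t ↑ T`" for some `u_T ∈ L³(T^d)`:
`∫‖u(t) − u_T‖³ → 0`. Then the solution continues to a classical mean-zero solution past `T`
(Minkowski: convergence in `L³` implies the Cauchy property).
[cite: RobinsonSadowski2014, Corollary 7 (p. 174)] -/
theorem Torus.classicalNS_continuation_of_tendsto_L3 (hd : Fintype.card d = 3) {ν T : ℝ}
    (hν : 0 < ν) (hT : 0 < T)
    {u : ℝ → UnitAddTorus d → EuclideanSpace ℝ d} {p : ℝ → UnitAddTorus d → ℝ}
    (h : Torus.IsClassicalNSSolutionOn (Ico 0 T) ν 0 u p)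
    (hmean : ∀ t ∈ Ico 0 T, Torus.HasZeroMean (u t))
    {uT : UnitAddTorus d → EuclideanSpace ℝ d} (huT : MemLp uT 3)
    (hlim : Tendsto (fun t => ∫ x, ‖u t x - uT x‖ ^ (3 : ℝ)) (𝓝[<] T) (𝓝 0)) :
    ∃ T' : ℝ, T < T' ∧ ∃ (u' : ℝ → UnitAddTorus d → EuclideanSpace ℝ d)
      (p' : ℝ → UnitAddTorus d → ℝ), Torus.IsClassicalNSSolutionOn (Icc 0 T') ν 0 u' p' ∧
        (∀ t ∈ Icc 0 T', Torus.HasZeroMean (u' t)) ∧ ∀ t ∈ Ico 0 T, u' t = u t := by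
  refine Torus.classicalNS_continuation_of_L3_cauchy hd hν h hmean fun η hη => ?_
  have hsm : ∀ t ∈ Ico 0 T, Torus.IsSmooth (u t) := fun t ht =>
    h.smooth_velocity.isSmooth_slice ht
  set ρ : ℝ := η ^ (1 / (3 : ℝ)) / 2 with hρ
  have hρ0 : 0 < ρ := by positivity
  have hev : ∀ᶠ t in 𝓝[<] T, ∫ x, ‖u t x - uT x‖ ^ (3 : ℝ) < ρ ^ 3 := by
    have h1 := (Metric.tendsto_nhds.1 hlim) (ρ ^ 3) (pow_pos hρ0 3)
    filter_upwards [h1] with t ht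
    rwa [Real.dist_eq, sub_zero,
      abs_of_nonneg (integral_nonneg fun _ => Real.rpow_nonneg (norm_nonneg _) _)] at ht
  obtain ⟨l, hlT, hl⟩ := mem_nhdsLT_iff_exists_Ioo_subset.1 hev
  have hlT' : l < T := hlT
  set t₁ : ℝ := max 0 ((l + T) / 2) with ht₁
  have ht₁0 : 0 ≤ t₁ := le_max_left _ _
  have ht₁T : t₁ < T := max_lt hT (by linarith)
  have hlt₁ : l < t₁ := lt_of_lt_of_le (by linarith) (le_max_right _ _)
  refine ⟨t₁, ⟨ht₁0, ht₁T⟩, fun t ht t' ht' => ?_⟩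
  have htI : t ∈ Ioo l T := ⟨hlt₁.trans_le ht.1, ht.2⟩
  have ht'I : t' ∈ Ioo l T := ⟨hlt₁.trans_le ht'.1, ht'.2⟩
  have hlt : ∫ x, ‖u t x - uT x‖ ^ (3 : ℝ) < ρ ^ 3 := hl htI
  have hlt' : ∫ x, ‖u t' x - uT x‖ ^ (3 : ℝ) < ρ ^ 3 := hl ht'I
  have h1 : (∫ x, ‖u t x - uT x‖ ^ (3 : ℝ)) ^ (1 / (3 : ℝ)) ≤ ρ :=
    l3_le_of_integral_le hρ0.le hlt.le
  have h2 : (∫ x, ‖u t' x - uT x‖ ^ (3 : ℝ)) ^ (1 / (3 : ℝ)) ≤ ρ :=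
    l3_le_of_integral_le hρ0.le hlt'.le
  have htT : t ∈ Ico 0 T := ⟨ht₁0.trans ht.1, ht.2⟩
  have ht'T : t' ∈ Ico 0 T := ⟨ht₁0.trans ht'.1, ht'.2⟩
  have m := l3_sub_le (μ := volume) ((hsm t htT).memLp 3) huT ((hsm t' ht'T).memLp 3)
  rw [l3_sub_comm uT (u t')] at m
  have hN : (∫ x, ‖u t x - u t' x‖ ^ (3 : ℝ)) ^ (1 / (3 : ℝ)) ≤ η ^ (1 / (3 : ℝ)) := by
    calc (∫ x, ‖u t x - u t' x‖ ^ (3 : ℝ)) ^ (1 / (3 : ℝ)) ≤ ρ + ρ := by linarith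
      _ = η ^ (1 / (3 : ℝ)) := by rw [hρ]; ring
  have hI0 : 0 ≤ ∫ x, ‖u t x - u t' x‖ ^ (3 : ℝ) :=
    integral_nonneg fun _ => Real.rpow_nonneg (norm_nonneg _) _
  calc ∫ x, ‖u t x - u t' x‖ ^ (3 : ℝ)
      = ((∫ x, ‖u t x - u t' x‖ ^ (3 : ℝ)) ^ (1 / (3 : ℝ))) ^ 3 := (l3_pow_three hI0).symm
    _ ≤ (η ^ (1 / (3 : ℝ))) ^ 3 := pow_le_pow_left₀ (Real.rpow_nonneg hI0 _) hN 3
    _ = η := l3_pow_three hη.le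

end Literature.Analysis.FluidPDE

end
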